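import Literature.AnabelianGeometry.AbsoluteAnabelian.AbsTopIII.Thm19TaggedProofs
import Literature.AnabelianGeometry.AbsoluteAnabelian.AbsTopIII.Thm19DictionaryBridge
import Literature.AnabelianGeometry.AbsoluteAnabelian.AbsTopIII.KummerFaithfulSubpadicHolds
import HarnessLib

/-!
# [AbsTopIII] Thm. 1.9 (d)(e), tagged statements of record: the input `Rmk_1_5_4_i` DISCHARGED

Mochizuki, *Topics in Absolute Anabelian Geometry III*, Thm. 1.9 (d)(e) p. 37–38 and Rmk. 1.5.4 (i) p. 33
("every sub-`p`-adic field is Kummer-faithful").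

The closers of record for the tagged statements `DescentKummerModel.Thm19dTagged` /
`DescentKummerModel.Thm19eTagged` (abc-iut SUBDAG-AbsTopIII-Thm19 v14: `DescentKummerModel.thm19dTagged_of_facts`,
`PlacedKummerModelV2.thm19eTagged_of_facts`) take abc-iut-L4-t1's named facts as hypotheses, among them
`Rmk_1_5_4_i` (FACT-LIST F-0369).  That fact is now a THEOREM of the tree
(`AbsTopIII.Rmk_1_5_4_i_holds`, `KummerFaithfulSubpadicHolds.lean`, abc-iut-f-080 p445449), so the
hypothesis is discharged BY NAME: Thm. 1.9 (d) at every law-abiding model rests on the FIVE named facts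
`Prop_1_8_i`, `Prop_1_8_ii`, `Prop_1_6_iii_units`, `Prop_1_6_iii_ker`, `Prop_1_6_i`; Thm. 1.9 (e) on those
five and the four Prop. 1.4 facts.  PROOF-ONLY; nothing here bears on [IUTchIII] Cor. 3.12; typed ≠ proved
for the remaining named facts (étale `π₁`, campaign L).
-/

noncomputable section

namespace Literature.AnabelianGeometry.AbsoluteAnabelian.AbsTopIII

universe u

/-- **Thm. 1.9 (d), tagged statement of record, with `Rmk_1_5_4_i` discharged**: for every
`DescentKummerModel` satisfying the named facts `Prop_1_8_i`, `Prop_1_8_ii`, `Prop_1_6_iii_units`,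
`Prop_1_6_iii_ker`, `Prop_1_6_i`, Thm. 1.9 (d) holds for every tagged system ("sub-`p`-adic ⟹
Kummer-faithful" being the theorem `Rmk_1_5_4_i_holds`). [cite: MochizukiAbsTopIII2015, Thm 1.9 (d) p.37] -/
theorem DescentKummerModel.thm19dTagged_of_facts' (N : DescentKummerModel.{u}) (h18i : N.Prop_1_8_i)
    (h18ii : N.Prop_1_8_ii) (h16u : N.Prop_1_6_iii_units) (h16k : N.Prop_1_6_iii_ker)
    (h16 : N.Prop_1_6_i) : N.Thm19dTagged :=
  N.thm19dTagged_of_facts h18i h18ii h16u h16k h16 Rmk_1_5_4_i_holds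

/-- **Thm. 1.9 (e), tagged statement of record, with `Rmk_1_5_4_i` discharged**: for every
`PlacedKummerModelV2` satisfying the five Prop. 1.6/1.8 facts and the four Prop. 1.4 facts, Thm. 1.9 (e)
holds for every saturated tagged system. [cite: MochizukiAbsTopIII2015, Thm 1.9 (e) p.38] -/
theorem PlacedKummerModelV2.thm19eTagged_of_facts' (N : PlacedKummerModelV2.{u}) (h18i : N.Prop_1_8_i)
    (h18ii : N.Prop_1_8_ii) (h16u : N.Prop_1_6_iii_units) (h16k : N.Prop_1_6_iii_ker)
    (h16 : N.Prop_1_6_i) (h14i : N.Prop_1_4_i) (h14 : N.Prop_1_4_i') (h142 : N.Prop_1_4_ii)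
    (hT14 : N.Prop_1_4_ii_transgression) : N.Thm19eTagged :=
  N.thm19eTagged_of_facts h18i h18ii h16u h16k h16 Rmk_1_5_4_i_holds h14i h14 h142 hT14

end Literature.AnabelianGeometry.AbsoluteAnabelian.AbsTopIII

end
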